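import Mathlib
import Summits.Schanuel.Schanuel.Theorems.RigidCoreMinimalCounterexampleInAclSelectionCore

/-!
# The TWO-SIDED selection core — crux stmt-Schanuel-0969 `RigidCore.MinimalCounterexampleInAcl`

Route `RigidCore`, crux (S*) `MinimalCounterexampleInAcl` (item stmt-Schanuel-0969), line `kernel-arithmetic-selection`
(lead prover-line-stmt-Schanuel-0969-c6-0, skeleton gen 19), `--supports stmt-Schanuel-0969`; registered stub
`stub_selectionCoreTwoSided`.

`stub_selectionCore` (Theorems/…SelectionCore.lean, p125080) selects with a `∅`-definable gadget `Φ` that DECAYS super-polynomially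
along all far mates (`Φ = e^{y₀²}`).  Gadgets such as `e^{y₀y₁}` or `e^{iy₀}` DEGENERATE super-polynomially but with a sign
depending on the chain of mates: on some chains `Φ → 0`, on others `Φ → ∞`.  This file proves the two-sided version: if along every
far mate EITHER `‖Φ y‖ (1+‖y₀‖)^M ≤ 1` OR `‖Φ y‖⁻¹ (1+‖y₀‖)^M ≤ 1`, then a relation `Σ_{j≤d} c_j(x,eˣ) Φ(x)^j = 0` whose END
coefficients are both non-zero at `(x, eˣ)` (`c₀(x,eˣ) ≠ 0 ≠ c_d(x,eˣ)` — the normal form of any algebraic relation after trimming,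
`exists_trim_top`) again cuts the mates down to a finite `∅`-definable set containing `x`: on a decaying mate the head coefficient
`c₀(y,e^y)` is squeezed (as in the one-sided core), on a blowing-up mate the relation is reversed (`Ψ = Φ(y)⁻¹`,
`Σ_j c_{d−j}(y,e^y) Ψ^j = 0`) and the TAIL coefficient `c_d(y,e^y)` is squeezed.
-/

noncomputable section

set_option linter.dupNamespace false

open Complex Set FirstOrder

namespace Summit.Schanuel.Schanuel.Cruxes.MinimalCounterexampleInAcl.KernelArithmeticSelection

open Literature.ModelTheory.ExponentialFields
open Summit.Schanuel.Schanuel.Theorems.AclSubsetLogFreeCore.Negative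
open Summit.Schanuel.Schanuel.Theorems.MinimalCounterexampleInAcl.Negative

/-! ## Trimming a relation at the top -/

/-- **Trimming the top of a relation.**  From `Σ_{j ≤ d} a_j E^j = 0` with `a₀ ≠ 0` one extracts `d' ≤ d` with `a_{d'} ≠ 0` and
`Σ_{j ≤ d'} a_j E^j = 0`, all the dropped coefficients `a_j`, `d' < j ≤ d`, being zero. [folklore] -/
theorem exists_trim_top {d : ℕ} (a : Fin (d + 1) → ℂ) (E : ℂ) (h0 : a 0 ≠ 0)
    (hsum : ∑ j : Fin (d + 1), a j * E ^ (j : ℕ) = 0) :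
    ∃ d' : ℕ, ∃ hd' : d' ≤ d, a ⟨d', Nat.lt_succ_of_le hd'⟩ ≠ 0 ∧
      (∀ j : Fin (d + 1), d' < (j : ℕ) → a j = 0) ∧
      ∑ j : Fin (d' + 1), a ⟨(j : ℕ), Nat.lt_succ_of_le ((Nat.le_of_lt_succ j.2).trans hd')⟩ * E ^ (j : ℕ) = 0 := by
  classical
  -- the largest index with a non-zero coefficient
  set T : Finset (Fin (d + 1)) := Finset.univ.filter fun j => a j ≠ 0 with hT
  have hT0 : (0 : Fin (d + 1)) ∈ T := by simp [hT, h0]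
  have hTne : T.Nonempty := ⟨0, hT0⟩
  set m : Fin (d + 1) := T.max' hTne with hm
  have hmT : m ∈ T := Finset.max'_mem T hTne
  have ham : a m ≠ 0 := by simpa [hT] using hmT
  have hmax : ∀ j : Fin (d + 1), a j ≠ 0 → j ≤ m := fun j hj =>
    Finset.le_max' T j (by simp [hT, hj])
  have hzero : ∀ j : Fin (d + 1), (m : ℕ) < (j : ℕ) → a j = 0 := by
    intro j hj
    by_contra hne
    exact absurd (Fin.le_def.1 (hmax j hne)) (not_le.2 hj)
  have hmd : (m : ℕ) ≤ d := Nat.le_of_lt_succ m.2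
  refine ⟨(m : ℕ), hmd, ?_, hzero, ?_⟩
  · have e : (⟨(m : ℕ), Nat.lt_succ_of_le hmd⟩ : Fin (d + 1)) = m := Fin.ext rfl
    rw [e]; exact ham
  · -- pass through sums over `Finset.range` with the zero-extended coefficient sequence
    set b : ℕ → ℂ := fun k => if h : k < d + 1 then a ⟨k, h⟩ else 0 with hb
    have hfull : ∑ j : Fin (d + 1), a j * E ^ (j : ℕ) = ∑ k ∈ Finset.range (d + 1), b k * E ^ k := by
      rw [← Fin.sum_univ_eq_sum_range (fun k => b k * E ^ k) (d + 1)]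
      refine Finset.sum_congr rfl fun j _ => ?_
      simp only [hb]
      rw [dif_pos j.2]
    have hpart : ∑ j : Fin ((m : ℕ) + 1), a ⟨(j : ℕ), Nat.lt_succ_of_le ((Nat.le_of_lt_succ j.2).trans hmd)⟩ * E ^ (j : ℕ) =
        ∑ k ∈ Finset.range ((m : ℕ) + 1), b k * E ^ k := by
      rw [← Fin.sum_univ_eq_sum_range (fun k => b k * E ^ k) ((m : ℕ) + 1)]
      refine Finset.sum_congr rfl fun j _ => ?_
      have hj : (j : ℕ) < d + 1 := Nat.lt_succ_of_le ((Nat.le_of_lt_succ j.2).trans hmd)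
      simp only [hb]
      rw [dif_pos hj]
    have hsub : ∑ k ∈ Finset.range ((m : ℕ) + 1), b k * E ^ k = ∑ k ∈ Finset.range (d + 1), b k * E ^ k := by
      refine Finset.sum_subset (Finset.range_subset_range.2 (Nat.succ_le_succ hmd)) fun k hk hk' => ?_
      have hk1 : k < d + 1 := Finset.mem_range.1 hk
      have hk2 : ¬ k < (m : ℕ) + 1 := fun h => hk' (Finset.mem_range.2 h)
      have : b k = 0 := by
        simp only [hb, hk1, dif_pos]
        exact hzero ⟨k, hk1⟩ (by simp; omega)
      rw [this, zero_mul]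
    rw [hpart, hsub, ← hfull, hsum]

/-! ## The reversed relation on a blowing-up mate -/

/-- Reversing a relation: if `Σ_{j ≤ d} a_j φ^j = 0` and `φ ≠ 0` then `Σ_{j ≤ d} a_{d-j} (φ⁻¹)^j = 0`. [folklore] -/
theorem sum_rev_mul_inv_pow_eq_zero {d : ℕ} (a : Fin (d + 1) → ℂ) {φ : ℂ} (hφ : φ ≠ 0)
    (hsum : ∑ j : Fin (d + 1), a j * φ ^ (j : ℕ) = 0) :
    ∑ j : Fin (d + 1), a (Fin.rev j) * φ⁻¹ ^ (j : ℕ) = 0 := by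
  have key : ∑ j : Fin (d + 1), a (Fin.rev j) * φ⁻¹ ^ (j : ℕ) = φ⁻¹ ^ d * ∑ j : Fin (d + 1), a j * φ ^ (j : ℕ) := by
    rw [Finset.mul_sum]
    rw [← Equiv.sum_comp Fin.revPerm (fun j => φ⁻¹ ^ d * (a j * φ ^ (j : ℕ)))]
    refine Finset.sum_congr rfl fun j _ => ?_
    simp only [Fin.revPerm_apply]
    have hj : (j : ℕ) ≤ d := Nat.le_of_lt_succ j.2
    have hrev : ((Fin.rev j : Fin (d + 1)) : ℕ) = d - (j : ℕ) := by
      rw [Fin.val_rev]; omega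
    rw [hrev]
    -- `a(rev j) φ⁻ʲ = φ⁻ᵈ (a (rev j) φ^{d-j})`
    have hpow : φ⁻¹ ^ d * φ ^ (d - (j : ℕ)) = φ⁻¹ ^ (j : ℕ) := by
      have e1 : φ⁻¹ ^ d = φ⁻¹ ^ (j : ℕ) * φ⁻¹ ^ (d - (j : ℕ)) := by
        rw [← pow_add, Nat.add_sub_cancel' hj]
      rw [e1, mul_assoc, ← mul_pow, inv_mul_cancel₀ hφ, one_pow, mul_one]
    calc a (Fin.rev j) * φ⁻¹ ^ (j : ℕ) = a (Fin.rev j) * (φ⁻¹ ^ d * φ ^ (d - (j : ℕ))) := by rw [hpow]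
      _ = φ⁻¹ ^ d * (a (Fin.rev j) * φ ^ (d - (j : ℕ))) := by ring
  rw [key, hsum, mul_zero]

/-! ## The two-sided bound on the selection set -/

/-- **The selection set is bounded in `y₀` — two-sided version.**  Under super-polynomial DEGENERATION of `Φ` along the mates
(decay OR blow-up at each far mate) and two-sided polynomial size of the coefficients along the locus, with `c₀(x,eˣ) ≠ 0` AND
`c_d(x,eˣ) ≠ 0`, every mate `y` of `x` with `Σ_j c_j(y, e^y) Φ(y)^j = 0` has `‖y₀‖ ≤ R*`. -/
theorem selectionSet_bounded_twoSided {x : Fin 2 → ℂ} {Φ : (Fin 2 → ℂ) → ℂ}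
    (hdeg : ∀ M : ℕ, ∃ R : ℝ, ∀ y : Fin 2 → ℂ, y ∈ locusMates x → R ≤ ‖y 0‖ →
      ‖Φ y‖ * (1 + ‖y 0‖) ^ M ≤ 1 ∨ ‖Φ y‖⁻¹ * (1 + ‖y 0‖) ^ M ≤ 1)
    (hgrowth : ∀ F : MvPolynomial (Fin 2 ⊕ Fin 2) ℚ, ∃ R C : ℝ, ∃ D : ℕ, 0 < C ∧ ∀ y : Fin 2 → ℂ,
      y ∈ locusPts x → R ≤ ‖y 0‖ →
        ‖MvPolynomial.aeval (Sum.elim y (cexp ∘ y)) F‖ ≤ C * (1 + ‖y 0‖) ^ D ∧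
        (MvPolynomial.aeval (Sum.elim x (cexp ∘ x)) F ≠ 0 →
          C⁻¹ * ((1 + ‖y 0‖) ^ D)⁻¹ ≤ ‖MvPolynomial.aeval (Sum.elim y (cexp ∘ y)) F‖))
    {d : ℕ} (c : Fin (d + 1) → MvPolynomial (Fin 2 ⊕ Fin 2) ℚ)
    (hc0 : MvPolynomial.aeval (Sum.elim x (cexp ∘ x)) (c 0) ≠ 0)
    (hcd : MvPolynomial.aeval (Sum.elim x (cexp ∘ x)) (c (Fin.last d)) ≠ 0) :
    ∃ R : ℝ, ∀ y : Fin 2 → ℂ, y ∈ locusMates x →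
      ∑ j : Fin (d + 1), MvPolynomial.aeval (Sum.elim y (cexp ∘ y)) (c j) * Φ y ^ (j : ℕ) = 0 →
        ‖y 0‖ ≤ R := by
  choose Rj Cj Dj hCj hj using fun j => hgrowth (c j)
  -- one decay exponent serving both ends
  set M : ℕ := Dj 0 + Dj (Fin.last d) + ∑ j, Dj j + 1 with hMdef
  obtain ⟨RM, hM⟩ := hdeg M
  obtain ⟨Rmax, hRmax⟩ := Finite.exists_le Rj
  set Cs : ℝ := ∑ j, Cj j with hCs
  have hCs0 : 0 ≤ Cs := Finset.sum_nonneg fun j _ => (hCj j).le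
  refine ⟨max (max RM Rmax) (max (Cj 0 * Cs) (Cj (Fin.last d) * Cs)), fun y hy hsum => not_lt.1 fun hlt => ?_⟩
  simp only [max_lt_iff] at hlt
  obtain ⟨⟨hRM, hRmax'⟩, hCC0, hCCd⟩ := hlt
  have hyP : y ∈ locusPts x := hy.2
  have hr0 : 0 ≤ ‖y 0‖ := norm_nonneg _
  have ht1 : 1 ≤ 1 + ‖y 0‖ := by linarith
  have hup : ∀ j, ‖MvPolynomial.aeval (Sum.elim y (cexp ∘ y)) (c j)‖ ≤ Cj j * (1 + ‖y 0‖) ^ Dj j :=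
    fun j => (hj j y hyP ((hRmax j).trans hRmax'.le)).1
  have hlow0 := (hj 0 y hyP ((hRmax 0).trans hRmax'.le)).2 hc0
  have hlowd := (hj (Fin.last d) y hyP ((hRmax (Fin.last d)).trans hRmax'.le)).2 hcd
  set a : Fin (d + 1) → ℂ := fun j => MvPolynomial.aeval (Sum.elim y (cexp ∘ y)) (c j) with ha
  -- decay versus blow-up at this mate
  rcases hM y hy hRM.le with hdec | hblow
  · -- DECAY: squeeze the head coefficient (exponent `Dj 0 + Σ Dj + 1 ≤ M`)
    have hdec' : ‖Φ y‖ * (1 + ‖y 0‖) ^ (Dj 0 + ∑ j, Dj j + 1) ≤ 1 := by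
      refine le_trans (mul_le_mul_of_nonneg_left (pow_le_pow_right₀ ht1 (by rw [hMdef]; omega)) (norm_nonneg _)) hdec
    have hone : (1 : ℝ) ≤ (1 + ‖y 0‖) ^ (Dj 0 + ∑ j, Dj j + 1) := one_le_pow₀ ht1
    have hφ1 : ‖Φ y‖ ≤ 1 :=
      calc ‖Φ y‖ = ‖Φ y‖ * 1 := (mul_one _).symm
        _ ≤ ‖Φ y‖ * (1 + ‖y 0‖) ^ (Dj 0 + ∑ j, Dj j + 1) := mul_le_mul_of_nonneg_left hone (norm_nonneg _)
        _ ≤ 1 := hdec'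
    have hhead := norm_head_le_of_sum_eq_zero a (Φ y) Cj Dj hr0 hsum hCj hup hφ1
    have key := one_add_le_of_sandwich (hCj 0) hCs0 hr0 hlow0 hhead hdec'
    linarith
  · -- BLOW-UP: `Φ y ≠ 0` unless the head coefficient vanishes, which the lower bound forbids
    by_cases hΦ0 : Φ y = 0
    · -- then `a 0 = 0`, contradicting the lower bound
      have ha0 : a 0 = 0 := by
        have h := hsum
        rw [Fin.sum_univ_succ] at h
        simp only [Fin.val_zero, pow_zero, mul_one, Fin.val_succ, hΦ0] at h
        simpa using h
      have hpos : 0 < (Cj 0)⁻¹ * ((1 + ‖y 0‖) ^ Dj 0)⁻¹ := by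
        have := hCj 0; positivity
      have : ‖a 0‖ = 0 := by rw [ha0, norm_zero]
      linarith [hlow0]
    · -- reverse the relation and squeeze the tail coefficient
      set Ψ : ℂ := (Φ y)⁻¹ with hΨ
      have hΨnorm : ‖Ψ‖ = ‖Φ y‖⁻¹ := by rw [hΨ, norm_inv]
      have hrev := sum_rev_mul_inv_pow_eq_zero a hΦ0 hsum
      have hblow' : ‖Ψ‖ * (1 + ‖y 0‖) ^ (Dj (Fin.last d) + ∑ j, Dj (Fin.rev j) + 1) ≤ 1 := by
        rw [hΨnorm]
        have hsumrev : ∑ j, Dj (Fin.rev j) = ∑ j, Dj j := Equiv.sum_comp Fin.revPerm Dj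
        rw [hsumrev]
        refine le_trans (mul_le_mul_of_nonneg_left (pow_le_pow_right₀ ht1 (by rw [hMdef]; omega)) ?_) hblow
        exact inv_nonneg.2 (norm_nonneg _)
      have hone : (1 : ℝ) ≤ (1 + ‖y 0‖) ^ (Dj (Fin.last d) + ∑ j, Dj (Fin.rev j) + 1) := one_le_pow₀ ht1
      have hΨ1 : ‖Ψ‖ ≤ 1 :=
        calc ‖Ψ‖ = ‖Ψ‖ * 1 := (mul_one _).symm
          _ ≤ ‖Ψ‖ * (1 + ‖y 0‖) ^ (Dj (Fin.last d) + ∑ j, Dj (Fin.rev j) + 1) :=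
              mul_le_mul_of_nonneg_left hone (norm_nonneg _)
          _ ≤ 1 := hblow'
      -- bounds for the reversed coefficients
      have hup' : ∀ j, ‖a (Fin.rev j)‖ ≤ Cj (Fin.rev j) * (1 + ‖y 0‖) ^ Dj (Fin.rev j) := fun j => hup (Fin.rev j)
      have hrev0 : (Fin.rev (0 : Fin (d + 1))) = Fin.last d := Fin.rev_zero _
      have hhead := norm_head_le_of_sum_eq_zero (fun j => a (Fin.rev j)) Ψ (fun j => Cj (Fin.rev j))
        (fun j => Dj (Fin.rev j)) hr0 hrev (fun j => hCj _) hup' hΨ1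
      simp only [hrev0] at hhead
      have hCs' : ∑ j, Cj (Fin.rev j) = Cs := Equiv.sum_comp Fin.revPerm Cj
      rw [hCs'] at hhead
      have key := one_add_le_of_sandwich (hCj (Fin.last d)) hCs0 hr0 hlowd hhead hblow'
      linarith

/-! ## The registered stub -/

/-- **Registered stub `stub_selectionCoreTwoSided` (PROVED) — THE TWO-SIDED SELECTION CORE.**  Let `x` be a rank-2 first failure
and `Φ` a `∅`-definable function that DEGENERATES super-polynomially along the mates: for every `M` there is `R` such that every
mate `y` with `‖y₀‖ ≥ R` has `‖Φ y‖ (1+‖y₀‖)^M ≤ 1` or `‖Φ y‖⁻¹ (1+‖y₀‖)^M ≤ 1`.  Assume two-sided polynomial size of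
`ℚ(x,eˣ)`-elements along the locus and finiteness of the mates with bounded first coordinate.  Then a relation
`Σ_{j ≤ d} c_j(x, eˣ) Φ(x)^j = 0` with `c₀(x, eˣ) ≠ 0` and `c_d(x, eˣ) ≠ 0` puts both coordinates of `x` in `acl^{ℂ_exp}(∅)`.
[cite: KirbyMacintyreOnshuus2012, §2] -/
theorem stub_selectionCoreTwoSided : ∀ (x : Fin 2 → ℂ), x ∈ Summit.Schanuel.Schanuel.Cruxes.MinimalCounterexampleInAcl.KernelArithmeticSelection.firstFailures 2 → ∀ (Φ : (Fin 2 → ℂ) → ℂ), (∅ : Set ℂ).DefinableFun Literature.ModelTheory.ExponentialFields.Language.expRing Φ → (∀ M : ℕ, ∃ R : ℝ, ∀ y : Fin 2 → ℂ, y ∈ Summit.Schanuel.Schanuel.Cruxes.MinimalCounterexampleInAcl.KernelArithmeticSelection.locusMates x → R ≤ ‖y 0‖ → (‖Φ y‖ * (1 + ‖y 0‖) ^ M ≤ 1 ∨ ‖Φ y‖⁻¹ * (1 + ‖y 0‖) ^ M ≤ 1)) → (∀ F : MvPolynomial (Fin 2 ⊕ Fin 2) ℚ, ∃ R C : ℝ,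 ∃ D : ℕ, 0 < C ∧ ∀ y : Fin 2 → ℂ, y ∈ Summit.Schanuel.Schanuel.Cruxes.MinimalCounterexampleInAcl.KernelArithmeticSelection.locusPts x → R ≤ ‖y 0‖ → ‖MvPolynomial.aeval (Sum.elim y (Complex.exp ∘ y)) F‖ ≤ C * (1 + ‖y 0‖) ^ D ∧ (MvPolynomial.aeval (Sum.elim x (Complex.exp ∘ x)) F ≠ 0 → C⁻¹ * ((1 + ‖y 0‖) ^ D)⁻¹ ≤ ‖MvPolynomial.aeval (Sum.elim y (Complex.exp ∘ y)) F‖)) → (∀ R : ℝ, Set.Finite {y : Fin 2 → ℂ | y ∈ Summit.Schanuel.Schanuel.Cruxes.MinimalCounterexampleInAcl.KernelArithmeticSelection.locusMates x ∧ ‖y 0‖ ≤ R}) → ∀ (d : ℕ) (c : Fin (d + 1) → MvPolynomial (Fin 2 ⊕ Fin 2) ℚ), MvPolynomial.aeval (Sum.elim x (Complex.exp ∘ x)) (c 0) ≠ 0 → MvPolynomial.aeval (Sum.elim x (Complex.exp ∘ x)) (c (Fin.last d)) ≠ 0 → ∑ j : Fin (d + 1), MvPolynomial.aeval (Sum.elim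 x (Complex.exp ∘ x)) (c j) * Φ x ^ (j : ℕ) = 0 → ∀ i, x i ∈ Summit.Schanuel.Schanuel.Theorems.AclSubsetLogFreeCore.Negative.expAcl := by
  intro x hx Φ hΦ hdeg hgrowth hloc d c hc0 hcd hrel i
  obtain ⟨R, hR⟩ := selectionSet_bounded_twoSided hdeg hgrowth c hc0 hcd
  have hfin : Set.Finite {y : Fin 2 → ℂ | y ∈ locusMates x ∧
      ∑ j : Fin (d + 1), MvPolynomial.aeval (Sum.elim y (cexp ∘ y)) (c j) * Φ y ^ (j : ℕ) = 0} :=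
    (hloc R).subset fun y hy => ⟨hy.1, hR y hy.1 hy.2⟩
  exact coord_mem_expAcl hfin (definable_selectionSet x hΦ c) ⟨self_mem_locusMates x hx.1, hrel⟩ i

/-- **Two-sided selection from a relation normalised at the bottom only** (`c₀(x,eˣ) ≠ 0`, as produced by the normal form of an
algebraic relation): trim the relation at the top (`exists_trim_top`) and apply `stub_selectionCoreTwoSided`. -/
theorem selectionCoreTwoSided_of_head {x : Fin 2 → ℂ} (hx : x ∈ firstFailures 2) {Φ : (Fin 2 → ℂ) → ℂ}
    (hΦ : (∅ : Set ℂ).DefinableFun Language.expRing Φ)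
    (hdeg : ∀ M : ℕ, ∃ R : ℝ, ∀ y : Fin 2 → ℂ, y ∈ locusMates x → R ≤ ‖y 0‖ →
      ‖Φ y‖ * (1 + ‖y 0‖) ^ M ≤ 1 ∨ ‖Φ y‖⁻¹ * (1 + ‖y 0‖) ^ M ≤ 1)
    (hgrowth : ∀ F : MvPolynomial (Fin 2 ⊕ Fin 2) ℚ, ∃ R C : ℝ, ∃ D : ℕ, 0 < C ∧ ∀ y : Fin 2 → ℂ,
      y ∈ locusPts x → R ≤ ‖y 0‖ →
        ‖MvPolynomial.aeval (Sum.elim y (cexp ∘ y)) F‖ ≤ C * (1 + ‖y 0‖) ^ D ∧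
        (MvPolynomial.aeval (Sum.elim x (cexp ∘ x)) F ≠ 0 →
          C⁻¹ * ((1 + ‖y 0‖) ^ D)⁻¹ ≤ ‖MvPolynomial.aeval (Sum.elim y (cexp ∘ y)) F‖))
    (hloc : ∀ R : ℝ, Set.Finite {y : Fin 2 → ℂ | y ∈ locusMates x ∧ ‖y 0‖ ≤ R})
    {d : ℕ} (c : Fin (d + 1) → MvPolynomial (Fin 2 ⊕ Fin 2) ℚ)
    (hc0 : MvPolynomial.aeval (Sum.elim x (cexp ∘ x)) (c 0) ≠ 0)
    (hrel : ∑ j : Fin (d + 1), MvPolynomial.aeval (Sum.elim x (cexp ∘ x)) (c j) * Φ x ^ (j : ℕ) = 0) :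
    ∀ i, x i ∈ expAcl := by
  obtain ⟨d', hd', hcd', -, hsum'⟩ :=
    exists_trim_top (fun j => MvPolynomial.aeval (Sum.elim x (cexp ∘ x)) (c j)) (Φ x) hc0 hrel
  -- the trimmed coefficient family
  set c' : Fin (d' + 1) → MvPolynomial (Fin 2 ⊕ Fin 2) ℚ :=
    fun j => c ⟨(j : ℕ), Nat.lt_succ_of_le ((Nat.le_of_lt_succ j.2).trans hd')⟩ with hc'
  have hc'0 : MvPolynomial.aeval (Sum.elim x (cexp ∘ x)) (c' 0) ≠ 0 := by
    have e : c' 0 = c 0 := by simp [hc']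
    rw [e]; exact hc0
  have hc'd : MvPolynomial.aeval (Sum.elim x (cexp ∘ x)) (c' (Fin.last d')) ≠ 0 := by
    have e : c' (Fin.last d') = c ⟨d', Nat.lt_succ_of_le hd'⟩ := by simp [hc']
    rw [e]; exact hcd'
  exact stub_selectionCoreTwoSided x hx Φ hΦ hdeg hgrowth hloc d' c' hc'0 hc'd (by simpa [hc'] using hsum')

end Summit.Schanuel.Schanuel.Cruxes.MinimalCounterexampleInAcl.KernelArithmeticSelection

end
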